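import Summits.QuantumFields.BalabanUV.T4Continuum.Spine.NE1p.DressedSmallFieldComponentInnerCarriersBonds

/-!
# T⁴ programme, spine estimate NE1′ (node O3b/H2) — THE (B3-count) CHAIN's SET-VALUED NESTED-TORI ENDs AT THE CARRIERS OF RECORD WITH
# PRINT's BONDS (PART 2 of «S51 ∕ S57 AT THE CARRIERS OF RECORD»): S51's set-valued END `…_componentSets_inner_nestedTori` (table pencil;
# print p. 19's n ≥ 1 components determining `Z′_i`) and S57 §3's μ-twin (road P1's source pencil) fired ONCE each at `C := R.carriers`,
# `L := R.F.L` (`3 ≤ L` from `R.F.hL11`), `N′ := R.cubesPerDir (k+1)`, scale `k+1`, `emb := domEmb R (k+1)` (`hscale` rfl), `Bnd := Bnd R`,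
# `bondsOf := bondsOfFineCubes hk`, `hb₀ := card_bondsOfFineCubes_le_real hk` (`b₀ = 4·L^{4m′}` LOCATED); [Balaban1988RGII] pp. 12, 17–20 KIND

Cell `pub-balaban`, sub-cell `t4`, BINDER-OWNERS row NE1′ (owner lineage t4-ne1p-p1, road P1); crew seat `b2b-balaban-t4-ne1p-formalise-leaf-01`
(LEAF PROVER 01, generation 15; filed by generation 16); **S62 PART 2 ∕ DAG N29zzzzza** (BOOKED typer R-T155 `CLAIMS.log` l.25330, cap 280,
read X231) = PART 2 of the crew S-row announced `CLAIMS.log` 2026-08-20 l.23514 ∕ INTENT 2026-08-21 l.24001 ∕ l.25213 (PART 1 = S62 p243495 ✓,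
`Spine/NE1p/DressedSmallFieldComponentInnerCarriersBonds`: the two SINGLE-component ENDs; owner PRE-ANSWERED GO l.23660; the typer gen 9 labels
both parts).  ADDITIVE — imports PART 1 ONLY (→ S57 p240443 ✓✓ → S51 p238434 ✓✓; → W-23c `Support/SubstrateBondsOfCubes` p239727 ✓); THEOREMS
ONLY (0 `def`, 0 `def … : Prop`, 0 cite); S51's `attachedPart_locE_le_of_coresAt_pencil_componentSets_inner_nestedTori` and S57 §3's
`muPart_locE_le_of_coresAt_pencil_componentSets_inner_nestedTori` are used BY NAME, ONCE each; W-23c's `bondsOfFineCubes` ∕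
`card_bondsOfFineCubes_le_real`, `domEmb`, `R.F.hL11` BY NAME; nothing restated.

WHY THIS FILE.  PART 1 moved the two single-component ENDs of the composed (B3-count) chain to the carriers of record with print's bonds
counted; the SET-VALUED pair (a NONEMPTY SET of anchored fine components per member `Z′_i`, each with one of N0u's admissible labels —
[Balaban1988RGII] p. 19 «For each Z′_i we sum over all possible components of Z₀ determining this Z′_i», «A sum over n components is
estimated by a product of n sums», KIND) is moved here with the SAME supplies, so that all four N0u-labelled nested-tori ENDs of S51 ∕ S57
read at `C := R.carriers` with `bondsOf`∕`hb₀`∕`b₀`, `emb`∕`hscale`, `hL` GONE: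
* §1 **`attachedPart_locE_le_of_coresAt_pencil_componentSets_inner_carriersBonds`** — S51's set-valued END ONCE;
* §2 **`muPart_locE_le_of_coresAt_pencil_componentSets_inner_carriersBonds`** — S57 §3 ONCE.
WHAT STAYS DISPLAYED (binders, by name; NOTHING instantiated on Bałaban's densities): as in PART 1 — cores `𝔊`, room, operator conditions,
class radii; (B1b)'s residue `terms`∕`hact` and `hadm` with its NONEMPTY-SUBSET clause and PRINT's bonds `P ⊆ bondsOfFineCubes hk W`,
`#W ≤ 2·#P` ((B1b)∕(2.35) READING); table letters `δ κ α₆ R_k s t`; the uncovered-cube weight; (B3-amp) `hAmp` with the set-product majorant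
(p. 18's clause KIND at `C₃(E₀+D₀)`, NOT asserted); the located clauses and rate bookkeeping with `u_k := e^{5R_k}·s·e^{4L^{4m′}·t}` and the
(2.29) clause at the amplitude `A·e^{5R}·e^{A}`; N0m's `hϱ`∕`hϱA` (§1), road P1's `h0`∕`h01`∕`hμ` (§2); `hk`.  WHAT IT SAYS FOR THE WALL
(the owner's reading, wall v1.8 of record, T4-DAG v48 §6 NE1 — v49–v51 carry it verbatim; nothing re-labelled here): as PART 1 — (B1b)'s
residue for the composed chain at the carriers is `terms`∕`hact`∕`hadm` with print's bonds; `emb`∕`hscale` rfl-level; `bondsOf`∕`hb₀`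
KERNEL (W-23c); identifications = pv22's ∕ the substrate's READING (D-pv22.3), asserted nowhere.  NOTHING of (B3) discharged on Bałaban's
(2.14) densities; 0 binders instantiated on Bałaban's densities; no wall item moves; wall v1.8 (T4-DAG v48) — words, not kind — does NOT
move; R-t4r2-Q2 NOT met thereby; NE1′ ⇐ the named binders — ONE label NEW ∕ NOT PRINTED ∕ NOT PROVED; spine PROVED 0∕9; count 9 unchanged.
KERNEL NOTE (F-ne1pp1-g31-1, as PART 1): `TDom` has no structural `DecidableEq` in S51 ∕ S57's context, the carriers' cone adds one; the
file-local `attribute [-instance] …TwoRuns.instDecidableEqTDom` keeps the ENDs' instance terms those of S51 ∕ S57 (else `whnf` times out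
on `ZMod (R.F.L * R.cubesPerDir (k+1))`'s by-cases decidability).  The erasure is scoped to the enclosing namespace (it lapses at `end`), hence repeated here and never exported.
HONEST FRAMING.  By-name composition of LANDED kernel theorems over binder SHAPES on the CONSTRUCTED carriers ∕ tori of record; cores ∕
labels are the cell's typed FORMAT of (2.14), NOT Bałaban's functions; `bondsOfFineCubes` is lattice combinatorics on run A's lattice, NOT
a statement about which bonds Bałaban's expansion produces; the μ-extension UNPRINTED ([Balaban1989LargeFieldII] p. 356); print's «L a
fixed large odd integer» is the family's FIELD, no numeral asserted; ABSOLUTE RULE honoured — nothing internally minted is cited,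
[folklore] tags on kernel theorems only.  Rung (B)+1 on ONE finite four-torus — NOT infinite volume, NOT a mass gap, NOT OS on ℝ⁴, NOT
Clay.  HONEST DEPENDENCY: continuum YM on T⁴ ⇐ BetaPertH ∧ nine spine estimates (0/9 proved); BetaPertH ⇐ (D1) ∧ (D4) ∧ CAP+tail;
G-an2-4 gates asym, D1 and NE2/3/4.
-/

noncomputable section

namespace Summit.QuantumFields.BalabanUV.T4Continuum.NE1p.DressedSmallFieldComponentInnerCarriersBondsSets

open Metric Set Complex MeasureTheory
open scoped BigOperators
open Literature.MathematicalPhysics.QuantumFieldTheory.Balaban1983to89 (GaugeGroup)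
open Literature.MathematicalPhysics.QuantumFieldTheory.Balaban1983to89.B13FamilySum (coveringFamilies)
open Literature.MathematicalPhysics.QuantumFieldTheory.Balaban1983to89.T4OutputRate (Carriers)
open Literature.MathematicalPhysics.QuantumFieldTheory.Balaban1983to89.B13Resummation (locE)
open Literature.MathematicalPhysics.QuantumFieldTheory.Balaban1983to89.TreeLengthTorus (TPt TDom tsys torusTreeLen)
open Literature.MathematicalPhysics.QuantumFieldTheory.Balaban1983to89.TreeLengthTorusGeometry (TTouch tgeometry)
open Literature.MathematicalPhysics.QuantumFieldTheory.Balaban1983to89.TreeLengthTorusTransfer (tclosureDom)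
open Literature.MathematicalPhysics.QuantumFieldTheory.Balaban1983to89.B12TreeDecay (K₀)
open Literature.MathematicalPhysics.QuantumFieldTheory.Balaban1983to89.B13Geometry236 (a236)
open Summit.QuantumFields.BalabanUV.T4Continuum.B13HistMeasurable (MeasPotFrame B13HistM)
open Summit.QuantumFields.BalabanUV.T4Continuum.B13TermParamGaussianBi (BiCore)
open Summit.QuantumFields.BalabanUV.T4Continuum.B13Carriers (TwoRuns)
open Summit.QuantumFields.BalabanUV.T4Continuum.B13InnerData (Bnd)
open Summit.QuantumFields.BalabanUV.T4Continuum.B13DomainGeometryTR (domEmb)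
open Summit.QuantumFields.BalabanUV.T4Continuum.SubstrateBondsOfCubes (bondsOfFineCubes card_bondsOfFineCubes_le_real)
open Summit.QuantumFields.BalabanUV.T4Continuum.NE1p.DressedSmallFieldComponentInnerNestedTori
  (attachedPart_locE_le_of_coresAt_pencil_componentSets_inner_nestedTori)
open Summit.QuantumFields.BalabanUV.T4Continuum.NE1p.DressedSmallFieldComponentInnerMuNestedTori
  (muPart_locE_le_of_coresAt_pencil_componentSets_inner_nestedTori)

-- F-ne1pp1-g31-1 (see PART 1's header and its mutant CB4): keep S51 ∕ S57's classical `DecidableEq (TDom 4 _)` by switching off the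
-- carriers' structural instance in THIS namespace too (the erasure is scoped: PART 1's lapsed at its closing `end`).
attribute [-instance] Summit.QuantumFields.BalabanUV.T4Continuum.B13Carriers.TwoRuns.instDecidableEqTDom

variable {G : Type} [GaugeGroup G] (R : TwoRuns G) {k : ℕ} (hk : k + 1 + R.m' ≤ R.F.m + R.K)
variable {P : MeasPotFrame R.carriers} {Op : Type*} [NormedAddCommGroup Op] [NormedSpace ℂ Op]

variable
  {𝒴 : ℕ → (Σ _ : Finset (TPt 4 (R.cubesPerDir (k + 1))), Σ F : Finset (tsys 4 (R.cubesPerDir (k + 1))).Dom, ∀ Z ∈ F,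
    Finset (Σ _ : (tsys 4 (R.F.L * R.cubesPerDir (k + 1))).Dom, (Σ _ : Finset (TPt 4 (R.F.L * R.cubesPerDir (k + 1))), Finset (tsys 4 (R.F.L * R.cubesPerDir (k + 1))).Dom × Finset (Bnd R)))) →
    Type*}
  {dom : ∀ k i, 𝒴 k i → R.carriers.Dom}
  {β : ℕ → (Σ _ : Finset (TPt 4 (R.cubesPerDir (k + 1))), Σ F : Finset (tsys 4 (R.cubesPerDir (k + 1))).Dom, ∀ Z ∈ F,
    Finset (Σ _ : (tsys 4 (R.F.L * R.cubesPerDir (k + 1))).Dom, (Σ _ : Finset (TPt 4 (R.F.L * R.cubesPerDir (k + 1))), Finset (tsys 4 (R.F.L * R.cubesPerDir (k + 1))).Dom × Finset (Bnd R)))) →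
    Type*}
  [∀ k i, MeasurableSpace (β k i)]
  {α : ℕ → (Σ _ : Finset (TPt 4 (R.cubesPerDir (k + 1))), Σ F : Finset (tsys 4 (R.cubesPerDir (k + 1))).Dom, ∀ Z ∈ F,
    Finset (Σ _ : (tsys 4 (R.F.L * R.cubesPerDir (k + 1))).Dom, (Σ _ : Finset (TPt 4 (R.F.L * R.cubesPerDir (k + 1))), Finset (tsys 4 (R.F.L * R.cubesPerDir (k + 1))).Dom × Finset (Bnd R)))) →
    Type*}
  [∀ k i, NormedAddCommGroup (α k i)] [∀ k i, InnerProductSpace ℝ (α k i)] [∀ k i, FiniteDimensional ℝ (α k i)]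
  [∀ k i, MeasurableSpace (α k i)] [∀ k i, BorelSpace (α k i)]

/-! ## §1 S51's SET-VALUED END AT THE CARRIERS OF RECORD WITH PRINT's BONDS (table pencil) -/

open Classical in
/-- **THE WHOLE (B3-count) CHAIN, A NONEMPTY SET OF COMPONENTS PER MEMBER, PRINT's BONDS COUNTED** (kernel; S51's
`attachedPart_locE_le_of_coresAt_pencil_componentSets_inner_nestedTori` ONCE BY NAME at `L := R.F.L` (`hL` from `R.F.hL11`),
`N′ := R.cubesPerDir (k+1)`, `C := R.carriers`, scale `k+1`, `emb := domEmb R (k+1)` (`hscale` by `rfl`), `Bnd := Bnd R`,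
`bondsOf := bondsOfFineCubes hk`, `hb₀ := card_bondsOfFineCubes_le_real hk`).  DISPLAYED: everything else of S51's set-valued END VERBATIM at
these instances (`hadm`'s NONEMPTY-SUBSET clause with `P ⊆ bondsOfFineCubes hk W`, `hAmp`'s set-product majorant, `h229` at the amplitude
`A·e^{5R}·e^{A}`).  Binders = S51's MINUS [`hL`, `emb`, `hscale`, `bondsOf`, `b₀`, `hb₀`] PLUS [`R`, `hk`] (section); rate `R` ↦ `Rout`.
Conclusion = the crew coarse-torus currency `4·(e·9·64·K₀(64,8)²)·A₁·e^{−r₁·d(X₀)}`. [folklore] -/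
theorem attachedPart_locE_le_of_coresAt_pencil_componentSets_inner_carriersBonds {Win : Set (ℕ → ℝ)}
    {ctr : ℕ → (ℕ → ℝ) → R.carriers.BgB → Op × B13HistM P} {ROp RHist R' : ℕ → ℝ}
    (𝔊 : ∀ k i, R.carriers.Dom → BiCore P (dom k i) Op (β k i) (α k i))
    {mq bq N₀ : ℕ → (Σ _ : Finset (TPt 4 (R.cubesPerDir (k + 1))), Σ F : Finset (tsys 4 (R.cubesPerDir (k + 1))).Dom, ∀ Z ∈ F,
      Finset (Σ _ : (tsys 4 (R.F.L * R.cubesPerDir (k + 1))).Dom, (Σ _ : Finset (TPt 4 (R.F.L * R.cubesPerDir (k + 1))), Finset (tsys 4 (R.F.L * R.cubesPerDir (k + 1))).Dom × Finset (Bnd R)))) →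
      R.carriers.Dom → ℝ}
    (hroom : ∀ k, ROp k < R' k)
    (hm : ∀ k, ∀ g ∈ Win, ∀ (U : R.carriers.BgB) (X : R.carriers.Dom), R.carriers.scale X = k → ∀ i, 0 < mq k i X)
    (hN : ∀ k, ∀ g ∈ Win, ∀ (U : R.carriers.BgB) (X : R.carriers.Dom), R.carriers.scale X = k → ∀ i,
      (∀ o ∈ ball (ctr k g U).1 (R' k), AEStronglyMeasurable ((𝔊 k i X).N o) (𝔊 k i X).lam) ∧
      (∀ p, DifferentiableOn ℂ (fun o => (𝔊 k i X).N o p) (ball (ctr k g U).1 (R' k))) ∧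
      (∀ o ∈ ball (ctr k g U).1 (R' k), ∀ p, ‖(𝔊 k i X).N o p‖ ≤ N₀ k i X))
    (hq : ∀ k, ∀ g ∈ Win, ∀ (U : R.carriers.BgB) (X : R.carriers.Dom), R.carriers.scale X = k → ∀ i,
      (∀ o ∈ ball (ctr k g U).1 (R' k),
        AEStronglyMeasurable (Function.uncurry ((𝔊 k i X).q o)) ((𝔊 k i X).lam.prod volume)) ∧
      (∀ p v, DifferentiableOn ℂ (fun o => (𝔊 k i X).q o p v) (ball (ctr k g U).1 (R' k))) ∧
      (∀ o ∈ ball (ctr k g U).1 (R' k), ∀ p v, mq k i X * ‖v‖ ^ 2 - bq k i X ≤ ((𝔊 k i X).q o p v).re))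
    {g : ℕ → ℝ} (hg : g ∈ Win) {U : R.carriers.BgB} {o : Op} {h₀ w : B13HistM P} {ϱ : ℝ}
    (hO : ‖o - (ctr (k + 1) g U).1‖ ≤ ROp (k + 1)) (hH : ‖h₀ - (ctr (k + 1) g U).2‖ + ϱ * ‖w‖ ≤ RHist (k + 1))
    {terms : (tsys 4 (R.cubesPerDir (k + 1))).Dom → Finset (Σ _ : Finset (TPt 4 (R.cubesPerDir (k + 1))), Σ F : Finset (tsys 4 (R.cubesPerDir (k + 1))).Dom, ∀ Z ∈ F,
      Finset (Σ _ : (tsys 4 (R.F.L * R.cubesPerDir (k + 1))).Dom, (Σ _ : Finset (TPt 4 (R.F.L * R.cubesPerDir (k + 1))), Finset (tsys 4 (R.F.L * R.cubesPerDir (k + 1))).Dom × Finset (Bnd R))))}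
    {act : ℂ → (tsys 4 (R.cubesPerDir (k + 1))).Dom → ℂ}
    (hact : ∀ σ ∈ ball (0 : ℂ) ϱ, ∀ Z, act σ Z = ∑ i ∈ terms Z, (𝔊 (k + 1) i (domEmb R (k + 1) Z)).termAt o (h₀ + σ • w))
    {A₀ A₁ Rkp r₁ : ℝ} (X₀ : (tsys 4 (R.cubesPerDir (k + 1))).Dom) (hA₀ : 0 ≤ A₀) (hA₁ : 0 ≤ A₁) (hr₁ : 0 ≤ r₁)
    (hrate : r₁ + 2 * (64 * Real.log 162) + 2 ≤ Rkp)
    (hsmall : (A₀ + ϱ * A₁) * Real.exp (5 * r₁ + 1) * K₀ 64 8 * 9 * 64 ≤ 1)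
    {δ κ α₆ Rk s t : ℝ}
    (hα₆ : 0 ≤ α₆) (hκk : 64 * Real.log 162 + 1 ≤ δ * κ) (h229k : Real.exp 1 * K₀ 64 8 * 64 * α₆ ≤ 1)
    (hs0 : 0 ≤ s) (hs1 : s ≤ 1) (ht : 0 ≤ t)
    {ε r Rout v : ℝ} (hε : 0 ≤ ε) (hv : 0 ≤ v)
    (hκR : 64 * Real.log 162 ≤ Rk - 64 * (Real.exp (Rk * 5) * s * Real.exp (4 * (R.F.L : ℝ) ^ (4 * R.m') * t)))
    (hrate2 : r + Rout ≤ (Rk - 64 * (Real.exp (Rk * 5) * s * Real.exp (4 * (R.F.L : ℝ) ^ (4 * R.m') * t)) - 64 * Real.log 162) * ((R.F.L : ℝ) / a236 R.F.L))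
    (hκ : 64 * Real.log 162 + 1 ≤ r)
    (h229 : Real.exp 1 * K₀ 64 8 * 64 *
      (ε * Real.exp (64 * (Real.exp (Rk * 5) * s * Real.exp (4 * (R.F.L : ℝ) ^ (4 * R.m') * t)) - 5 * Rk) * ((3 : ℝ) ^ 4 * (R.F.L : ℝ) ^ 4) * K₀ 64 8 *
          Real.exp (5 * Rout) *
        Real.exp (ε * Real.exp (64 * (Real.exp (Rk * 5) * s * Real.exp (4 * (R.F.L : ℝ) ^ (4 * R.m') * t)) - 5 * Rk) * ((3 : ℝ) ^ 4 * (R.F.L : ℝ) ^ 4) *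
          K₀ 64 8)) ≤ 1)
    (hRR : Rkp ≤ Rout - 64 * (v * Real.exp (Rout * 5)))
    (hadm : ∀ Z : (tsys 4 (R.cubesPerDir (k + 1))).Dom, ∀ l ∈ terms Z, l.1 ⊆ Z.1 ∧
      l.2.1 ∈ coveringFamilies Finset.univ (fun Y : (tsys 4 (R.cubesPerDir (k + 1))).Dom => Y.1) (Z.1 \ l.1) ∧
      ∀ Z' (h : Z' ∈ l.2.1), (l.2.2 Z' h).Nonempty ∧
        l.2.2 Z' h ⊆
          ((Finset.univ : Finset (tsys 4 (R.F.L * R.cubesPerDir (k + 1))).Dom).filter (fun Z₀ => tclosureDom R.F.L (R.cubesPerDir (k + 1)) Z₀ = Z')).sigma fun Z₀ =>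
            Z₀.1.powerset.sigma fun W =>
              coveringFamilies Finset.univ (fun Y : (tsys 4 (R.F.L * R.cubesPerDir (k + 1))).Dom => Y.1) (Z₀.1 \ W) ×ˢ
                (bondsOfFineCubes hk W).powerset.filter fun P => W.card ≤ 2 * P.card)
    (hAmp : ∀ Z : (tsys 4 (R.cubesPerDir (k + 1))).Dom, Z.1 ⊆ X₀.1 → ∀ l ∈ terms Z,
      (𝔊 (k + 1) l (domEmb R (k + 1) Z)).lam.real univ * ((𝔊 (k + 1) l (domEmb R (k + 1) Z)).wB * N₀ (k + 1) l (domEmb R (k + 1) Z) * Real.exp (bq (k + 1) l (domEmb R (k + 1) Z))) *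
          (Real.pi / (mq (k + 1) l (domEmb R (k + 1) Z) / 2)) ^ (Module.finrank ℝ (α (k + 1) l) / 2 : ℝ) *
        Real.exp ((𝔊 (k + 1) l (domEmb R (k + 1) Z)).N₁ * (‖h₀‖ + ϱ * ‖w‖)) ≤
      (A₀ + ϱ * A₁) * (v ^ l.1.card * ∏ x ∈ l.2.1.attach, ∏ j ∈ l.2.2 x.1 x.2, (ε *
        ((∏ Y ∈ j.2.2.1, (α₆ * Real.exp (-(δ * κ * torusTreeLen Y.1)) * Real.exp (-(Rk * (torusTreeLen Y.1 + 5))))) *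
          (s ^ 2 * t) ^ j.2.2.2.card))))
    (hϱ : 2 ≤ ϱ) (hϱA : A₀ ≤ ϱ * A₁) :
    ‖locE (TTouch (d := 4) (N := R.cubesPerDir (k + 1))) (fun Z : (tsys 4 (R.cubesPerDir (k + 1))).Dom => Z.1) (act 1) X₀.1 -
        locE (TTouch (d := 4) (N := R.cubesPerDir (k + 1))) (fun Z : (tsys 4 (R.cubesPerDir (k + 1))).Dom => Z.1) (act 0) X₀.1‖ ≤
      4 * (Real.exp 1 * 9 * 64 * K₀ 64 8 ^ 2) * A₁ * Real.exp (-(r₁ * torusTreeLen X₀.1)) :=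
  attachedPart_locE_le_of_coresAt_pencil_componentSets_inner_nestedTori (L := R.F.L) (N' := R.cubesPerDir (k + 1))
    (by have := R.F.hL11; omega) 𝔊 hroom hm hN hq hg hO hH (emb := fun Z => domEmb R (k + 1) Z) (fun _ => rfl) hact X₀ hA₀ hA₁
    hr₁ hrate hsmall (bondsOfFineCubes hk) hα₆ hκk h229k hs0 hs1 ht (fun W => card_bondsOfFineCubes_le_real hk W) hε hv hκR hrate2 hκ
    h229 hRR hadm hAmp hϱ hϱA

/-! ## §2 S57 §3's μ-TWIN AT THE CARRIERS OF RECORD WITH PRINT's BONDS (road P1's source pencil) -/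

open Classical in
/-- **THE SET-VALUED μ-TWIN, PRINT's BONDS COUNTED** (kernel; S57 §3 `muPart_locE_le_of_coresAt_pencil_componentSets_inner_nestedTori` ONCE
BY NAME with the SAME supplies as §1).  The source window (`μ₁`, `μ₀`, `sμ`) and the direction `v` occur ONLY in `hH`, `hact`, `hAmp` and
the conclusion.  Binders = S57 §3's MINUS [`hL`, `emb`, `hscale`, `bondsOf`, `b₀`, `hb₀`] PLUS [`R`, `hk`]; rate `R` ↦ `Rout`.  Conclusion =
the torus μ-currency `e·9·64·K₀(64,8)²·A·e^{−r₁·d(X₀)}·μ₀∕(μ₁ − μ₀)`. [folklore] -/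
theorem muPart_locE_le_of_coresAt_pencil_componentSets_inner_carriersBonds {Win : Set (ℕ → ℝ)}
    {ctr : ℕ → (ℕ → ℝ) → R.carriers.BgB → Op × B13HistM P} {ROp RHist R' : ℕ → ℝ}
    (𝔊 : ∀ k i, R.carriers.Dom → BiCore P (dom k i) Op (β k i) (α k i))
    {mq bq N₀ : ℕ → (Σ _ : Finset (TPt 4 (R.cubesPerDir (k + 1))), Σ F : Finset (tsys 4 (R.cubesPerDir (k + 1))).Dom, ∀ Z ∈ F,
      Finset (Σ _ : (tsys 4 (R.F.L * R.cubesPerDir (k + 1))).Dom, (Σ _ : Finset (TPt 4 (R.F.L * R.cubesPerDir (k + 1))), Finset (tsys 4 (R.F.L * R.cubesPerDir (k + 1))).Dom × Finset (Bnd R)))) →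
      R.carriers.Dom → ℝ}
    (hroom : ∀ k, ROp k < R' k)
    (hm : ∀ k, ∀ g ∈ Win, ∀ (U : R.carriers.BgB) (X : R.carriers.Dom), R.carriers.scale X = k → ∀ i, 0 < mq k i X)
    (hN : ∀ k, ∀ g ∈ Win, ∀ (U : R.carriers.BgB) (X : R.carriers.Dom), R.carriers.scale X = k → ∀ i,
      (∀ o ∈ ball (ctr k g U).1 (R' k), AEStronglyMeasurable ((𝔊 k i X).N o) (𝔊 k i X).lam) ∧
      (∀ p, DifferentiableOn ℂ (fun o => (𝔊 k i X).N o p) (ball (ctr k g U).1 (R' k))) ∧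
      (∀ o ∈ ball (ctr k g U).1 (R' k), ∀ p, ‖(𝔊 k i X).N o p‖ ≤ N₀ k i X))
    (hq : ∀ k, ∀ g ∈ Win, ∀ (U : R.carriers.BgB) (X : R.carriers.Dom), R.carriers.scale X = k → ∀ i,
      (∀ o ∈ ball (ctr k g U).1 (R' k),
        AEStronglyMeasurable (Function.uncurry ((𝔊 k i X).q o)) ((𝔊 k i X).lam.prod volume)) ∧
      (∀ p v, DifferentiableOn ℂ (fun o => (𝔊 k i X).q o p v) (ball (ctr k g U).1 (R' k))) ∧
      (∀ o ∈ ball (ctr k g U).1 (R' k), ∀ p v, mq k i X * ‖v‖ ^ 2 - bq k i X ≤ ((𝔊 k i X).q o p v).re))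
    {g : ℕ → ℝ} (hg : g ∈ Win) {U : R.carriers.BgB} {o : Op} {h₀ v : B13HistM P} {μ₁ : ℝ}
    (hO : ‖o - (ctr (k + 1) g U).1‖ ≤ ROp (k + 1)) (hH : ‖h₀ - (ctr (k + 1) g U).2‖ + μ₁ * ‖v‖ ≤ RHist (k + 1))
    {terms : (tsys 4 (R.cubesPerDir (k + 1))).Dom → Finset (Σ _ : Finset (TPt 4 (R.cubesPerDir (k + 1))), Σ F : Finset (tsys 4 (R.cubesPerDir (k + 1))).Dom, ∀ Z ∈ F,
      Finset (Σ _ : (tsys 4 (R.F.L * R.cubesPerDir (k + 1))).Dom, (Σ _ : Finset (TPt 4 (R.F.L * R.cubesPerDir (k + 1))), Finset (tsys 4 (R.F.L * R.cubesPerDir (k + 1))).Dom × Finset (Bnd R))))}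
    {act : ℂ → (tsys 4 (R.cubesPerDir (k + 1))).Dom → ℂ}
    (hact : ∀ σ ∈ ball (0 : ℂ) μ₁, ∀ Z, act σ Z = ∑ i ∈ terms Z, (𝔊 (k + 1) i (domEmb R (k + 1) Z)).termAt o (h₀ + σ • v))
    {A Rkp r₁ μ₀ : ℝ} (X₀ : (tsys 4 (R.cubesPerDir (k + 1))).Dom) {sμ : ℂ} (hA : 0 ≤ A) (hr₁ : 0 ≤ r₁)
    (hrate : r₁ + 2 * (64 * Real.log 162) + 2 ≤ Rkp) (hsmall : A * Real.exp (5 * r₁ + 1) * K₀ 64 8 * 9 * 64 ≤ 1)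
    {δ κ α₆ Rk s t : ℝ}
    (hα₆ : 0 ≤ α₆) (hκk : 64 * Real.log 162 + 1 ≤ δ * κ) (h229k : Real.exp 1 * K₀ 64 8 * 64 * α₆ ≤ 1)
    (hs0 : 0 ≤ s) (hs1 : s ≤ 1) (ht : 0 ≤ t)
    {ε r Rout vW : ℝ} (hε : 0 ≤ ε) (hvW : 0 ≤ vW)
    (hκR : 64 * Real.log 162 ≤ Rk - 64 * (Real.exp (Rk * 5) * s * Real.exp (4 * (R.F.L : ℝ) ^ (4 * R.m') * t)))
    (hrate2 : r + Rout ≤ (Rk - 64 * (Real.exp (Rk * 5) * s * Real.exp (4 * (R.F.L : ℝ) ^ (4 * R.m') * t)) - 64 * Real.log 162) * ((R.F.L : ℝ) / a236 R.F.L))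
    (hκ : 64 * Real.log 162 + 1 ≤ r)
    (h229 : Real.exp 1 * K₀ 64 8 * 64 *
      (ε * Real.exp (64 * (Real.exp (Rk * 5) * s * Real.exp (4 * (R.F.L : ℝ) ^ (4 * R.m') * t)) - 5 * Rk) * ((3 : ℝ) ^ 4 * (R.F.L : ℝ) ^ 4) * K₀ 64 8 *
          Real.exp (5 * Rout) *
        Real.exp (ε * Real.exp (64 * (Real.exp (Rk * 5) * s * Real.exp (4 * (R.F.L : ℝ) ^ (4 * R.m') * t)) - 5 * Rk) * ((3 : ℝ) ^ 4 * (R.F.L : ℝ) ^ 4) *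
          K₀ 64 8)) ≤ 1)
    (hRR : Rkp ≤ Rout - 64 * (vW * Real.exp (Rout * 5)))
    (hadm : ∀ Z : (tsys 4 (R.cubesPerDir (k + 1))).Dom, ∀ l ∈ terms Z, l.1 ⊆ Z.1 ∧
      l.2.1 ∈ coveringFamilies Finset.univ (fun Y : (tsys 4 (R.cubesPerDir (k + 1))).Dom => Y.1) (Z.1 \ l.1) ∧
      ∀ Z' (h : Z' ∈ l.2.1), (l.2.2 Z' h).Nonempty ∧
        l.2.2 Z' h ⊆
          ((Finset.univ : Finset (tsys 4 (R.F.L * R.cubesPerDir (k + 1))).Dom).filter (fun Z₀ => tclosureDom R.F.L (R.cubesPerDir (k + 1)) Z₀ = Z')).sigma fun Z₀ =>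
            Z₀.1.powerset.sigma fun W =>
              coveringFamilies Finset.univ (fun Y : (tsys 4 (R.F.L * R.cubesPerDir (k + 1))).Dom => Y.1) (Z₀.1 \ W) ×ˢ
                (bondsOfFineCubes hk W).powerset.filter fun P => W.card ≤ 2 * P.card)
    (hAmp : ∀ Z : (tsys 4 (R.cubesPerDir (k + 1))).Dom, Z.1 ⊆ X₀.1 → ∀ l ∈ terms Z,
      (𝔊 (k + 1) l (domEmb R (k + 1) Z)).lam.real univ * ((𝔊 (k + 1) l (domEmb R (k + 1) Z)).wB * N₀ (k + 1) l (domEmb R (k + 1) Z) * Real.exp (bq (k + 1) l (domEmb R (k + 1) Z))) *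
          (Real.pi / (mq (k + 1) l (domEmb R (k + 1) Z) / 2)) ^ (Module.finrank ℝ (α (k + 1) l) / 2 : ℝ) *
        Real.exp ((𝔊 (k + 1) l (domEmb R (k + 1) Z)).N₁ * (‖h₀‖ + μ₁ * ‖v‖)) ≤
      A * (vW ^ l.1.card * ∏ x ∈ l.2.1.attach, ∏ j ∈ l.2.2 x.1 x.2, (ε *
        ((∏ Y ∈ j.2.2.1, (α₆ * Real.exp (-(δ * κ * torusTreeLen Y.1)) * Real.exp (-(Rk * (torusTreeLen Y.1 + 5))))) *
          (s ^ 2 * t) ^ j.2.2.2.card))))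
    (h0 : 0 < μ₀) (h01 : μ₀ < μ₁) (hμ : ‖sμ‖ ≤ μ₀) :
    ‖locE (TTouch (d := 4) (N := R.cubesPerDir (k + 1))) (fun Z : (tsys 4 (R.cubesPerDir (k + 1))).Dom => Z.1) (act sμ) X₀.1 -
        locE (TTouch (d := 4) (N := R.cubesPerDir (k + 1))) (fun Z : (tsys 4 (R.cubesPerDir (k + 1))).Dom => Z.1) (act 0) X₀.1‖ ≤
      Real.exp 1 * 9 * 64 * K₀ 64 8 ^ 2 * A * Real.exp (-(r₁ * torusTreeLen X₀.1)) * (μ₀ / (μ₁ - μ₀)) :=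
  muPart_locE_le_of_coresAt_pencil_componentSets_inner_nestedTori (L := R.F.L) (N' := R.cubesPerDir (k + 1))
    (by have := R.F.hL11; omega) 𝔊 hroom hm hN hq hg hO hH (emb := fun Z => domEmb R (k + 1) Z) (fun _ => rfl) hact X₀ hA hr₁
    hrate hsmall (bondsOfFineCubes hk) hα₆ hκk h229k hs0 hs1 ht (fun W => card_bondsOfFineCubes_le_real hk W) hε hvW hκR hrate2 hκ
    h229 hRR hadm hAmp h0 h01 hμ

end Summit.QuantumFields.BalabanUV.T4Continuum.NE1p.DressedSmallFieldComponentInnerCarriersBondsSets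

end
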